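import Literature.Computability.Complexity.TrigDyadicFP
import HarnessLib

/-!
# `cos(2πy)`, `sin(2πy)` at a RATIONAL number of turns `y`, to any dyadic precision, in polynomial time

Topic `Computability/Complexity`, sequel of `TrigDyadicFP.lean` (which treats the angles `2π/2ᵐ` of the
textbook QFT). A phase gadget (`QuantumComplexity/PhaseGadgetAssemblyGen.lean`,
`DyadicPhaseThresholds.lean`) that multiplies by a LABEL-DEPENDENT unit scalar `e^{2πiy}` — the
character values `e^{2πi αj/(p−1)}` of van Dam–Seroussi's Gauss-sum algorithm
(`Cryptography/VanDamSeroussiGaussSums.lean`, §3.2 Fact 5 and Lemma 1 of arXiv:quant-ph/0207131) — needs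
the integers `⌊2ᵏ cos(2πy)⌉`, `⌊2ᵏ sin(2πy)⌉` for a rational `y` read off registers; a classical
machine (the decider of the oracle language feeding those registers) must compute them in time
polynomial in `k` and the size of `y`. This file provides them by RANGE REDUCTION to `[0, 1/8]` turns
and the Taylor polynomials of `TrigDyadicFP.lean` on `[0, 1]` (Abramowitz–Stegun 4.3.65–66; `π` through
`MachinPi.piApprox`; `cos`, `sin` are `1`-Lipschitz):

* `TrigTurn.cosEighth k u ≈ cos(2πu)` for `0 ≤ u ≤ 1/4` (`cosTaylor` at `2π̃u` if `u ≤ 1/8`, else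
  `sinTaylor` at `2π̃(1/4 − u)`), **`abs_cos_sub_cosEighth_le`**: error `≤ 2⁻ᵏ`;
* `TrigTurn.cosTurn k y ≈ cos(2πy)` for `0 ≤ y ≤ 1` (`y ↦ 1 − y` onto `[0, 1/2]`, then
  `y ↦ 1/2 − y` with a sign onto `[0, 1/4]`), **`abs_cos_sub_cosTurn_le`**: error `≤ 2⁻ᵏ`;
  `TrigTurn.sinTurn k y = cosTurn k (y ∓ 1/4 …)`, **`abs_sin_sub_sinTurn_le`**;
* the dyadic integers `cosTurnDyadic k y = ⌊2ᵏ · cosTurn (k+1) y⌉`, `sinTurnDyadic`, with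
  `|cos(2πy) − cosTurnDyadic k y/2ᵏ| ≤ 2⁻ᵏ` (`abs_cos_sub_cosTurnDyadic_div_le`, likewise for `sin`);
* **polynomial time** in the unary `k` and the code of `y` (`CodeFP`, encoder `encodeRat`):
  `codeFP_cosEighth`, `codeFP_cosTurn`, `codeFP_sinTurn`,
  `codeFP_cosTurnDyadic`, `codeFP_sinTurnDyadic`.

Everything here is proved; definitions have bodies; no named fact is introduced.

## References

* M. Abramowitz, I. A. Stegun, *Handbook of Mathematical Functions*, NBS 1964, 4.3.65–4.3.66, 4.3.44
  (reduction formulas) [AbramowitzStegun1964].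
* W. van Dam, G. Seroussi, arXiv:quant-ph/0207131 (2002), §3.2 Fact 5 (phase kickback of character
  values) [VanDamSeroussi2002].
* K.-I. Ko, *Complexity Theory of Real Functions*, Birkhäuser 1991, §2 [Ko1991].
-/

noncomputable section

namespace Literature.Computability.Complexity

open _root_.Computability Finset
open Literature.Algebra.EuclideanLattices (encodeRat)

namespace TrigTurn

open TrigDyadic MachinPi

/-! ### The reduced range `[0, 1/4]` -/

/-- **`cos(2πu)` for `0 ≤ u ≤ 1/4`** at precision `k`: the Taylor value of `cos` at `2π̃u` if
`u ≤ 1/8` (angle `≤ π/4 ≤ 1`), else the Taylor value of `sin` at `2π̃(1/4 − u)`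
(`cos θ = sin(π/2 − θ)`), `π̃ = piApprox (k+2)`, `k + 2` terms. [cite: AbramowitzStegun1964, 4.3.65–66 and 4.3.44] -/
def cosEighth (k : ℕ) (u : ℚ) : ℚ :=
  if u ≤ 1 / 8 then cosTaylor (k + 2) (2 * piApprox (k + 2) * u)
  else sinTaylor (k + 2) (2 * piApprox (k + 2) * (1 / 4 - u))

/-- The stand-in angle `2π̃u` is within `2⁻ᵏ⁻¹/8… ≤ 2⁻ᵏ⁻¹` of `2πu` for `0 ≤ u ≤ 1/8`, and lies in
`[0, 1]`. [folklore] -/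
theorem angle_bounds {k : ℕ} {u : ℚ} (h0 : 0 ≤ u) (h8 : u ≤ 1 / 8) :
    |2 * Real.pi * u - ((2 * piApprox (k + 2) * u : ℚ) : ℝ)| ≤ 1 / (2 : ℝ) ^ (k + 1) ∧
      (0 : ℚ) ≤ 2 * piApprox (k + 2) * u ∧ 2 * piApprox (k + 2) * u ≤ 1 := by
  obtain ⟨hp2, hp4⟩ := GaussIntegral.piApprox_mem (k + 2)
  have hu0 : (0 : ℝ) ≤ u := by exact_mod_cast h0
  have hu8 : (u : ℝ) ≤ 1 / 8 := by have := (Rat.cast_le (K := ℝ)).2 h8; push_cast at this; exact this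
  have hpi := abs_pi_sub_piApprox_le (k + 2)
  refine ⟨?_, ?_, ?_⟩
  · push_cast
    rw [show 2 * Real.pi * (u : ℝ) - 2 * (piApprox (k + 2) : ℝ) * u = (2 * u) * (Real.pi - piApprox (k + 2)) by ring,
      abs_mul, abs_of_nonneg (by positivity)]
    calc 2 * (u : ℝ) * |Real.pi - piApprox (k + 2)| ≤ 2 * (1 / 8) * (1 / (2 * (2 : ℝ) ^ (k + 2))) := by gcongr
      _ ≤ 1 / (2 : ℝ) ^ (k + 1) := by
          rw [pow_succ, pow_succ]
          have : (0 : ℝ) < 2 ^ k := by positivity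
          field_simp
          nlinarith
  · have : (0 : ℝ) ≤ ((2 * piApprox (k + 2) * u : ℚ) : ℝ) := by push_cast; nlinarith
    exact_mod_cast this
  · have : ((2 * piApprox (k + 2) * u : ℚ) : ℝ) ≤ 1 := by push_cast; nlinarith
    exact_mod_cast this

/-- **`|cos(2πu) − cosEighth k u| ≤ 2⁻ᵏ` for `0 ≤ u ≤ 1/4`.** [cite: AbramowitzStegun1964, 4.3.65–66] -/
theorem abs_cos_sub_cosEighth_le (k : ℕ) {u : ℚ} (h0 : 0 ≤ u) (h4 : u ≤ 1 / 4) :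
    |Real.cos (2 * Real.pi * u) - (cosEighth k u : ℝ)| ≤ 1 / (2 : ℝ) ^ k := by
  have hfac := two_pow_succ_le_factorial k
  have hhalf : 1 / (2 : ℝ) ^ (k + 1) + 1 / (2 : ℝ) ^ (k + 1) = 1 / (2 : ℝ) ^ k := by
    rw [pow_succ]; field_simp; ring
  unfold cosEighth
  by_cases h8 : u ≤ 1 / 8
  · rw [if_pos h8]
    obtain ⟨hA, hq0, hq1⟩ := angle_bounds (k := k) h0 h8
    have hT := abs_cos_sub_cosTaylor_le (k + 2) hq0 hq1
    have hL := Real.abs_cos_sub_cos_le (2 * Real.pi * u) ((2 * piApprox (k + 2) * u : ℚ) : ℝ)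
    calc |Real.cos (2 * Real.pi * u) - (cosTaylor (k + 2) (2 * piApprox (k + 2) * u) : ℝ)|
        = |(Real.cos (2 * Real.pi * u) - Real.cos ((2 * piApprox (k + 2) * u : ℚ) : ℝ)) +
            (Real.cos ((2 * piApprox (k + 2) * u : ℚ) : ℝ) - cosTaylor (k + 2) (2 * piApprox (k + 2) * u))| := by ring_nf
      _ ≤ |Real.cos (2 * Real.pi * u) - Real.cos ((2 * piApprox (k + 2) * u : ℚ) : ℝ)| +
            |Real.cos ((2 * piApprox (k + 2) * u : ℚ) : ℝ) - cosTaylor (k + 2) (2 * piApprox (k + 2) * u)| := abs_add_le _ _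
      _ ≤ 1 / (2 : ℝ) ^ (k + 1) + 1 / ((2 * (k + 2)).factorial : ℝ) := add_le_add (hL.trans hA) hT
      _ ≤ 1 / (2 : ℝ) ^ (k + 1) + 1 / (2 : ℝ) ^ (k + 1) := by gcongr
      _ = 1 / (2 : ℝ) ^ k := hhalf
  · rw [if_neg h8]
    push Not at h8
    have hv0 : (0 : ℚ) ≤ 1 / 4 - u := by linarith
    have hv8 : 1 / 4 - u ≤ (1 : ℚ) / 8 := by linarith
    obtain ⟨hA, hq0, hq1⟩ := angle_bounds (k := k) hv0 hv8
    have hT := abs_sin_sub_sinTaylor_le (k + 2) hq0 hq1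
    have hcos : Real.cos (2 * Real.pi * u) = Real.sin (2 * Real.pi * ((1 / 4 - u : ℚ) : ℝ)) := by
      rw [← Real.sin_pi_div_two_sub]; congr 1; push_cast; ring
    rw [hcos]
    have hL := Real.abs_sin_sub_sin_le (2 * Real.pi * ((1 / 4 - u : ℚ) : ℝ)) ((2 * piApprox (k + 2) * (1 / 4 - u) : ℚ) : ℝ)
    have hfac' : (2 : ℝ) ^ (k + 1) ≤ ((2 * (k + 2) + 1).factorial : ℝ) :=
      hfac.trans (by exact_mod_cast Nat.factorial_le (by omega))
    calc |Real.sin (2 * Real.pi * ((1 / 4 - u : ℚ) : ℝ)) - (sinTaylor (k + 2) (2 * piApprox (k + 2) * (1 / 4 - u)) : ℝ)|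
        = |(Real.sin (2 * Real.pi * ((1 / 4 - u : ℚ) : ℝ)) - Real.sin ((2 * piApprox (k + 2) * (1 / 4 - u) : ℚ) : ℝ)) +
            (Real.sin ((2 * piApprox (k + 2) * (1 / 4 - u) : ℚ) : ℝ) - sinTaylor (k + 2) (2 * piApprox (k + 2) * (1 / 4 - u)))| := by
          ring_nf
      _ ≤ |Real.sin (2 * Real.pi * ((1 / 4 - u : ℚ) : ℝ)) - Real.sin ((2 * piApprox (k + 2) * (1 / 4 - u) : ℚ) : ℝ)| +
            |Real.sin ((2 * piApprox (k + 2) * (1 / 4 - u) : ℚ) : ℝ) - sinTaylor (k + 2) (2 * piApprox (k + 2) * (1 / 4 - u))| :=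
          abs_add_le _ _
      _ ≤ 1 / (2 : ℝ) ^ (k + 1) + 1 / ((2 * (k + 2) + 1).factorial : ℝ) := add_le_add (hL.trans hA) hT
      _ ≤ 1 / (2 : ℝ) ^ (k + 1) + 1 / (2 : ℝ) ^ (k + 1) := by gcongr
      _ = 1 / (2 : ℝ) ^ k := hhalf

/-! ### The full circle -/

/-- Reduction of `y ∈ [0, 1]` to `[0, 1/2]`: `cos(2π(1 − y)) = cos(2πy)`. [cite: AbramowitzStegun1964, 4.3.44] -/
def redHalf (y : ℚ) : ℚ := if y ≤ 1 / 2 then y else 1 - y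

/-- The sign on `[0, 1/2]`: `+` on `[0, 1/4]`, `−` on `(1/4, 1/2]`. [cite: AbramowitzStegun1964, 4.3.44] -/
def sgnQuarter (y : ℚ) : ℚ := if y ≤ 1 / 4 then 1 else -1

/-- Reduction of `y ∈ [0, 1/2]` to `[0, 1/4]`: `cos(2πy) = −cos(2π(1/2 − y))`. [cite: AbramowitzStegun1964, 4.3.44] -/
def redQuarter (y : ℚ) : ℚ := if y ≤ 1 / 4 then y else 1 / 2 - y

/-- **`cos(2πy)` for `0 ≤ y ≤ 1` at precision `k`**, by range reduction to `cosEighth`.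
[cite: AbramowitzStegun1964, 4.3.44 and 4.3.66] -/
def cosTurn (k : ℕ) (y : ℚ) : ℚ := sgnQuarter (redHalf y) * cosEighth k (redQuarter (redHalf y))

/-- `cos(2π · redHalf y) = cos(2πy)` and `redHalf y ∈ [0, 1/2]` for `y ∈ [0, 1]`. [folklore] -/
theorem cos_redHalf {y : ℚ} (h0 : 0 ≤ y) (h1 : y ≤ 1) :
    Real.cos (2 * Real.pi * (redHalf y : ℚ)) = Real.cos (2 * Real.pi * y) ∧ 0 ≤ redHalf y ∧ redHalf y ≤ 1 / 2 := by
  unfold redHalf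
  split_ifs with h
  · exact ⟨rfl, h0, h⟩
  · push Not at h
    refine ⟨?_, by linarith, by linarith⟩
    rw [show (2 * Real.pi * ((1 - y : ℚ) : ℝ)) = 2 * Real.pi - 2 * Real.pi * y by push_cast; ring, Real.cos_two_pi_sub]

/-- `cos(2πy) = sgnQuarter y · cos(2π · redQuarter y)` and `redQuarter y ∈ [0, 1/4]` for
`y ∈ [0, 1/2]`; the sign has modulus one. [folklore] -/
theorem cos_redQuarter {y : ℚ} (h0 : 0 ≤ y) (h2 : y ≤ 1 / 2) :
    Real.cos (2 * Real.pi * y) = (sgnQuarter y : ℝ) * Real.cos (2 * Real.pi * (redQuarter y : ℚ)) ∧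
      0 ≤ redQuarter y ∧ redQuarter y ≤ 1 / 4 ∧ |(sgnQuarter y : ℝ)| = 1 := by
  unfold sgnQuarter redQuarter
  split_ifs with h
  · exact ⟨by push_cast; ring, h0, h, by simp⟩
  · push Not at h
    refine ⟨?_, by linarith, by linarith, by simp⟩
    rw [show (2 * Real.pi * ((1 / 2 - y : ℚ) : ℝ)) = Real.pi - 2 * Real.pi * y by push_cast; ring, Real.cos_pi_sub]
    push_cast; ring

/-- **`|cos(2πy) − cosTurn k y| ≤ 2⁻ᵏ` for `0 ≤ y ≤ 1`.** [cite: AbramowitzStegun1964, 4.3.44 and 4.3.65–66] -/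
theorem abs_cos_sub_cosTurn_le (k : ℕ) {y : ℚ} (h0 : 0 ≤ y) (h1 : y ≤ 1) :
    |Real.cos (2 * Real.pi * y) - (cosTurn k y : ℝ)| ≤ 1 / (2 : ℝ) ^ k := by
  obtain ⟨hc1, hr0, hr1⟩ := cos_redHalf h0 h1
  obtain ⟨hc2, hq0, hq1, hs⟩ := cos_redQuarter hr0 hr1
  have hE := abs_cos_sub_cosEighth_le k hq0 hq1
  unfold cosTurn
  rw [← hc1, hc2]
  push_cast
  rw [← mul_sub, abs_mul, hs, one_mul]
  exact hE

/-- **`sin(2πy)` for `0 ≤ y ≤ 1` at precision `k`**: `sin(2πy) = cos(2π(y − 1/4)) = cos(2π(y + 3/4))`.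
[cite: AbramowitzStegun1964, 4.3.44] -/
def sinTurn (k : ℕ) (y : ℚ) : ℚ := cosTurn k (if 1 / 4 ≤ y then y - 1 / 4 else y + 3 / 4)

/-- **`|sin(2πy) − sinTurn k y| ≤ 2⁻ᵏ` for `0 ≤ y ≤ 1`.** [cite: AbramowitzStegun1964, 4.3.44 and 4.3.65–66] -/
theorem abs_sin_sub_sinTurn_le (k : ℕ) {y : ℚ} (h0 : 0 ≤ y) (h1 : y ≤ 1) :
    |Real.sin (2 * Real.pi * y) - (sinTurn k y : ℝ)| ≤ 1 / (2 : ℝ) ^ k := by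
  unfold sinTurn
  split_ifs with h
  · have := abs_cos_sub_cosTurn_le k (y := y - 1 / 4) (by linarith) (by linarith)
    rwa [show (2 * Real.pi * ((y - 1 / 4 : ℚ) : ℝ)) = 2 * Real.pi * y - Real.pi / 2 by push_cast; ring,
      Real.cos_sub_pi_div_two] at this
  · push Not at h
    have := abs_cos_sub_cosTurn_le k (y := y + 3 / 4) (by linarith) (by linarith)
    rwa [show (2 * Real.pi * ((y + 3 / 4 : ℚ) : ℝ)) = (2 * Real.pi * y - Real.pi / 2) + 2 * Real.pi by push_cast; ring,
      Real.cos_add_two_pi, Real.cos_sub_pi_div_two] at this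

/-! ### The dyadic integers -/

/-- **The dyadic integer for `cos(2πy)`**: `⌊2ᵏ · cosTurn (k+1) y⌉`. [cite: Ko1991, §2] -/
def cosTurnDyadic (k : ℕ) (y : ℚ) : ℤ := round ((((2 : ℕ) ^ k : ℕ) : ℤ) / ((1 : ℕ) : ℚ) * cosTurn (k + 1) y)

/-- **The dyadic integer for `sin(2πy)`**: `⌊2ᵏ · sinTurn (k+1) y⌉`. [cite: Ko1991, §2] -/
def sinTurnDyadic (k : ℕ) (y : ℚ) : ℤ := round ((((2 : ℕ) ^ k : ℕ) : ℤ) / ((1 : ℕ) : ℚ) * sinTurn (k + 1) y)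

/-- **`|cos(2πy) − cosTurnDyadic k y / 2ᵏ| ≤ 2⁻ᵏ`** for `0 ≤ y ≤ 1`. [cite: Ko1991, §2] -/
theorem abs_cos_sub_cosTurnDyadic_div_le (k : ℕ) {y : ℚ} (h0 : 0 ≤ y) (h1 : y ≤ 1) :
    |Real.cos (2 * Real.pi * y) - (cosTurnDyadic k y : ℝ) / (2 : ℝ) ^ k| ≤ 1 / (2 : ℝ) ^ k := by
  unfold cosTurnDyadic
  apply abs_sub_round_div_le
  have := abs_cos_sub_cosTurn_le (k + 1) h0 h1
  rwa [pow_succ] at this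

/-- **`|sin(2πy) − sinTurnDyadic k y / 2ᵏ| ≤ 2⁻ᵏ`** for `0 ≤ y ≤ 1`. [cite: Ko1991, §2] -/
theorem abs_sin_sub_sinTurnDyadic_div_le (k : ℕ) {y : ℚ} (h0 : 0 ≤ y) (h1 : y ≤ 1) :
    |Real.sin (2 * Real.pi * y) - (sinTurnDyadic k y : ℝ) / (2 : ℝ) ^ k| ≤ 1 / (2 : ℝ) ^ k := by
  unfold sinTurnDyadic
  apply abs_sub_round_div_le
  have := abs_sin_sub_sinTurn_le (k + 1) h0 h1
  rwa [pow_succ] at this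

/-! ### Polynomial time -/

open CodeFP

/-- Comparison of rationals on codes: `(q, r) ↦ [q ≤ r]` (through the sign of the numerator of `r − q`;
a local copy of `CodeFP.ratLe` of `Cryptography/RejectionSamplerArithFP.lean`, whose import closure —
Gaussian rejection samplers — does not belong here). [folklore] -/
private theorem ratLe : CodeFP (pairE encodeRat encodeRat) bitE (fun p => decide (p.1 ≤ p.2)) := by
  have hdiff : CodeFP (pairE encodeRat encodeRat) encodeRat (fun p => p.2 + (-1 : ℚ) * p.1) :=
    (ratAdd.comp ((snd _ _).pair (ratMul.comp ((const _ (-1 : ℚ)).pair (fst _ _)))) :)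
  have hnum : CodeFP (pairE encodeRat encodeRat) intE (fun p => (p.2 + (-1 : ℚ) * p.1).num) := (ratNumDen.comp hdiff).fst'
  refine ((intLe.comp ((const _ (0 : ℤ)).pair hnum)).congr fun p => ?_)
  have key : (0 ≤ (p.2 + -1 * p.1).num) ↔ p.1 ≤ p.2 := by
    rw [Rat.num_nonneg, show p.2 + -1 * p.1 = p.2 - p.1 by ring, sub_nonneg]
  simp only [key]

/-- A comparison with a rational constant. [folklore] -/
private theorem ratLeConst (c : ℚ) : CodeFP encodeRat bitE (fun q => decide (q ≤ c)) :=
  (ratLe.comp ((CodeFP.id _).pair (const _ c)) :)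

/-- A comparison with a rational constant on the left. [folklore] -/
private theorem constLeRat (c : ℚ) : CodeFP encodeRat bitE (fun q => decide (c ≤ q)) :=
  (ratLe.comp ((const _ c).pair (CodeFP.id _)) :)

/-- An affine map `q ↦ a q + b` of rationals on codes. [folklore] -/
private theorem ratAffine (a b : ℚ) : CodeFP encodeRat encodeRat (fun q => a * q + b) :=
  (ratAdd.comp ((ratMul.comp ((const _ a).pair (CodeFP.id _))).pair (const _ b)) :)

/-- **`⟨1ᵏ, u⟩ ↦ cosEighth k u` is polynomial time.** [cite: Ko1991, §2] -/
theorem codeFP_cosEighth : CodeFP (pairE unE encodeRat) encodeRat (fun p => cosEighth p.1 p.2) := by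
  have hk : CodeFP (pairE unE encodeRat) unE (fun p => p.1) := fst _ _
  have hu : CodeFP (pairE unE encodeRat) encodeRat (fun p => p.2) := snd _ _
  have hk2 : CodeFP (pairE unE encodeRat) unE (fun p => p.1 + 2) := (unSucc.comp (unSucc.comp hk) :)
  have hpi : CodeFP (pairE unE encodeRat) encodeRat (fun p => piApprox (p.1 + 2)) := (codeFP_piApprox.comp hk2 :)
  have ha1 : CodeFP (pairE unE encodeRat) encodeRat (fun p => 2 * piApprox (p.1 + 2) * p.2) :=
    (ratMul.comp ((ratMul.comp ((const _ (2 : ℚ)).pair hpi)).pair hu) :)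
  have hv : CodeFP (pairE unE encodeRat) encodeRat (fun p => (-1 : ℚ) * p.2 + 1 / 4) := ((ratAffine (-1) (1 / 4)).comp hu :)
  have ha2 : CodeFP (pairE unE encodeRat) encodeRat (fun p => 2 * piApprox (p.1 + 2) * ((-1 : ℚ) * p.2 + 1 / 4)) :=
    (ratMul.comp ((ratMul.comp ((const _ (2 : ℚ)).pair hpi)).pair hv) :)
  have hc : CodeFP (pairE unE encodeRat) encodeRat (fun p => cosTaylor (p.1 + 2) (2 * piApprox (p.1 + 2) * p.2)) :=
    (codeFP_cosTaylor.comp (hk2.pair ha1) :)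
  have hs : CodeFP (pairE unE encodeRat) encodeRat (fun p => sinTaylor (p.1 + 2) (2 * piApprox (p.1 + 2) * ((-1 : ℚ) * p.2 + 1 / 4))) :=
    (codeFP_sinTaylor.comp (hk2.pair ha2) :)
  have htest : CodeFP (pairE unE encodeRat) bitE (fun p => decide (p.2 ≤ 1 / 8)) := ((ratLeConst (1 / 8)).comp hu :)
  refine ((htest.ite hc hs).congr fun p => ?_)
  unfold cosEighth
  rw [show (1 / 4 - p.2 : ℚ) = -1 * p.2 + 1 / 4 by ring]
  by_cases h : p.2 ≤ 1 / 8
  · rw [if_pos h, decide_eq_true h]; rfl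
  · rw [if_neg h, decide_eq_false h]; rfl

/-- `redHalf` on codes. [folklore] -/
theorem codeFP_redHalf : CodeFP encodeRat encodeRat redHalf := by
  refine (((ratLeConst (1 / 2)).ite (CodeFP.id _) (ratAffine (-1) 1)).congr fun q => ?_)
  unfold redHalf
  by_cases h : q ≤ 1 / 2
  · rw [if_pos h, decide_eq_true h]; rfl
  · rw [if_neg h, decide_eq_false h]; simp only [Bool.false_eq_true, ↓reduceIte]; ring

/-- `sgnQuarter` on codes. [folklore] -/
theorem codeFP_sgnQuarter : CodeFP encodeRat encodeRat sgnQuarter := by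
  refine (((ratLeConst (1 / 4)).ite (const _ (1 : ℚ)) (const _ (-1 : ℚ))).congr fun q => ?_)
  unfold sgnQuarter
  by_cases h : q ≤ 1 / 4
  · rw [if_pos h, decide_eq_true h]; rfl
  · rw [if_neg h, decide_eq_false h]; rfl

/-- `redQuarter` on codes. [folklore] -/
theorem codeFP_redQuarter : CodeFP encodeRat encodeRat redQuarter := by
  refine (((ratLeConst (1 / 4)).ite (CodeFP.id _) (ratAffine (-1) (1 / 2))).congr fun q => ?_)
  unfold redQuarter
  by_cases h : q ≤ 1 / 4
  · rw [if_pos h, decide_eq_true h]; rfl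
  · rw [if_neg h, decide_eq_false h]; simp only [Bool.false_eq_true, ↓reduceIte]; ring

/-- **`⟨1ᵏ, y⟩ ↦ cosTurn k y` is polynomial time.** [cite: Ko1991, §2] -/
theorem codeFP_cosTurn : CodeFP (pairE unE encodeRat) encodeRat (fun p => cosTurn p.1 p.2) := by
  have hk : CodeFP (pairE unE encodeRat) unE (fun p => p.1) := fst _ _
  have hr : CodeFP (pairE unE encodeRat) encodeRat (fun p => redHalf p.2) := (codeFP_redHalf.comp (snd _ _) :)
  have hs : CodeFP (pairE unE encodeRat) encodeRat (fun p => sgnQuarter (redHalf p.2)) := (codeFP_sgnQuarter.comp hr :)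
  have hq : CodeFP (pairE unE encodeRat) encodeRat (fun p => redQuarter (redHalf p.2)) := (codeFP_redQuarter.comp hr :)
  have hc : CodeFP (pairE unE encodeRat) encodeRat (fun p => cosEighth p.1 (redQuarter (redHalf p.2))) :=
    (codeFP_cosEighth.comp (hk.pair hq) :)
  exact (ratMul.comp (hs.pair hc)).congr fun _ => rfl

/-- **`⟨1ᵏ, y⟩ ↦ sinTurn k y` is polynomial time.** [cite: Ko1991, §2] -/
theorem codeFP_sinTurn : CodeFP (pairE unE encodeRat) encodeRat (fun p => sinTurn p.1 p.2) := by
  have hk : CodeFP (pairE unE encodeRat) unE (fun p => p.1) := fst _ _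
  have hy : CodeFP (pairE unE encodeRat) encodeRat (fun p => p.2) := snd _ _
  have htest : CodeFP (pairE unE encodeRat) bitE (fun p => decide (1 / 4 ≤ p.2)) := ((constLeRat (1 / 4)).comp hy :)
  have hsh : CodeFP (pairE unE encodeRat) encodeRat (fun p => if 1 / 4 ≤ p.2 then p.2 - 1 / 4 else p.2 + 3 / 4) := by
    refine ((htest.ite ((ratAffine 1 (-1 / 4)).comp hy) ((ratAffine 1 (3 / 4)).comp hy)).congr fun p => ?_)
    by_cases h : 1 / 4 ≤ p.2
    · rw [if_pos h, decide_eq_true h]; simp only [↓reduceIte]; ring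
    · rw [if_neg h, decide_eq_false h]; simp only [Bool.false_eq_true, ↓reduceIte]; ring
  exact (codeFP_cosTurn.comp (hk.pair hsh)).congr fun _ => rfl

/-- **`⟨1ᵏ, y⟩ ↦ cosTurnDyadic k y` is polynomial time.** [cite: Ko1991, §2] -/
theorem codeFP_cosTurnDyadic : CodeFP (pairE unE encodeRat) intE (fun p => cosTurnDyadic p.1 p.2) := by
  have h2k : CodeFP (pairE unE encodeRat) encodeRat (fun p => ((((2 : ℕ) ^ p.1 : ℕ) : ℤ) : ℚ) / ((1 : ℕ) : ℚ)) :=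
    (ratOfIntNat.comp ((intOfNat.comp (natPow.comp ((const _ 2).pair (fst _ _)))).pair (const _ 1)) :)
  have hc : CodeFP (pairE unE encodeRat) encodeRat (fun p => cosTurn (p.1 + 1) p.2) :=
    (codeFP_cosTurn.comp ((unSucc.comp (fst _ _)).pair (snd _ _)) :)
  exact (ratRound.comp (ratMul.comp (h2k.pair hc))).congr fun _ => rfl

/-- **`⟨1ᵏ, y⟩ ↦ sinTurnDyadic k y` is polynomial time.** [cite: Ko1991, §2] -/
theorem codeFP_sinTurnDyadic : CodeFP (pairE unE encodeRat) intE (fun p => sinTurnDyadic p.1 p.2) := by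
  have h2k : CodeFP (pairE unE encodeRat) encodeRat (fun p => ((((2 : ℕ) ^ p.1 : ℕ) : ℤ) : ℚ) / ((1 : ℕ) : ℚ)) :=
    (ratOfIntNat.comp ((intOfNat.comp (natPow.comp ((const _ 2).pair (fst _ _)))).pair (const _ 1)) :)
  have hs : CodeFP (pairE unE encodeRat) encodeRat (fun p => sinTurn (p.1 + 1) p.2) :=
    (codeFP_sinTurn.comp ((unSucc.comp (fst _ _)).pair (snd _ _)) :)
  exact (ratRound.comp (ratMul.comp (h2k.pair hs))).congr fun _ => rfl

end TrigTurn

end Literature.Computability.Complexity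

end
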